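import Literature.Probability.RandomPlanarGeometry.HexSAWBrickWallStripFugacityWidthOneSexticLower
import Literature.Probability.RandomPlanarGeometry.HexSAWSurfaceSecondOrderSharp
import Literature.Probability.RandomPlanarGeometry.HexSAWStripSurfaceLimit
import Literature.Probability.RandomPlanarGeometry.HexSAWSurfaceWallRateEq
import HarnessLib

/-!
# The one-wall second-order law for EVERY strip width: `y + 1/y ≤ μ_T(y,1)² ≤ y + 1/y + 8748/y²` (`T ≥ 1`, `y ≥ 200`)

Topic `Literature/Probability/RandomPlanarGeometry` (assembles three lines of the lane: `HexSAWBrickWallStripFugacityWidthOneSexticLower.lean`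
— the width-one law from below, `y ≤ s(s−y)(s−1)`, `max(y,1) < s` for `s = μ_1(y,1)²`; `HexSAWSurfaceSecondOrderSharp.lean` (a-p6) — the
half-plane window `β(y)² − y − 1/y ∈ [−26247/y³, 8748/y²]`; `HexSAWStripSurfaceLimit.lean` / `HexSAWSurfaceWallRateEq.lean` —
`μ_T(y,1) ≤ μ(y) = β(y)`; and `HexSAWBrickWallStripFugacityLevel0.lean` — `μ_T(y,1)` non-decreasing in `T`).  Source of the objects:
N. R. Beaton, M. Bousquet-Mélou, J. de Gier, H. Duminil-Copin, A. J. Guttmann, CMP 326 (2014), arXiv:1109.0358v5, §3.2 Proposition 7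
(p. 11): the printed one-wall strip rate `μ_T(y) = μ_T(1,y) = μ_T(y,1)` (`HexBW.stripMuY₀ T y`), increasing in `T` to the half-plane
rate `μ(y)` (`HV.surfaceMu`); §3.1 Proposition 5 (μ(y) ≥ max(μ, √y)) and the remark after it (Rychlewski–Whittington [RW11]: μ(y) ∼ √y).  The paper has no second-order term; the lane's half-plane law
(a-p6) is `β(y)² = y + 1/y + O(y⁻²)`.

## Statements (namespace `Literature.Probability.RandomPlanarGeometry.SAW.HexBW`, all PROVED, standard axioms)

* `stripMuY₀_sq_le_sharp (T) (1 ≤ y) : μ_T(y,1)² ≤ y + 1/y + 8748/y²` (strip ≤ half-plane ≤ SHARP);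
* `sharp_le_stripMuY₀_sq (1 ≤ T) (1 ≤ y) : y + y/(U(U−1)) ≤ μ_T(y,1)²`, `U := y + 1/y + 8748/y²` (width one from below, then monotone in `T`);
* ★★ **`stripMuY₀_sq_mem_Icc (1 ≤ T) (200 ≤ y) : μ_T(y,1)² ∈ [y + 1/y, y + 1/y + 8748/y²]`** — the one-wall SECOND-ORDER LAW holds
  for every strip width `T ≥ 1` with the SAME coefficient `1` as the half plane, uniformly in `T` (at `T = 0`, a single row, the rate
  is `√y` exactly and the coefficient is `0` — excluded);
* ★★ `abs_mul_stripMuY₀_sq_sub_sub_one_le (1 ≤ T) (200 ≤ y) : |y·(μ_T(y,1)² − y) − 1| ≤ 8748/y`,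
  `tendsto_mul_stripMuY₀_sq_sub (1 ≤ T) : y·(μ_T(y,1)² − y) → 1` as `y → ∞`, for each `T ≥ 1`;
* ★★ `surfaceMu_sq_sub_stripMuY₀_sq_mem_Icc (1 ≤ T) (200 ≤ y) : μ(y)² − μ_T(y,1)² ∈ [0, 8748/y²]` — adsorbed-phase locality,
  UNIFORM in the width: the one-cell slit already carries the half-plane free energy up to `O(y⁻²)`.

No new definitions (proof-only module).  The constant `8748` and the threshold are a-p6's; `200` is what makes `U(U−1) ≤ y²`.
-/

noncomputable section

open Filter Topology Literature.Probability.LatticeModels Literature.Probability.Percolation SimpleGraph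

namespace Literature.Probability.RandomPlanarGeometry.SAW.HexBW

variable {y : ℝ} {T : ℕ}

/-- **`μ_T(y,1)² ≤ y + 1/y + 8748/y²`** for every `T` and `y ≥ 1`: the strip rate is at most the half-plane rate `μ(y) = β(y)`, whose
square a-p6's window bounds. [cite: BeatonBousquetMelouDeGierDuminilCopinGuttmann2014, §3.2 Proposition 7 (arXiv v5 p. 11: μ_T(y) increasing to μ(y)) and §3.1 Proposition 5 (μ(y) ≥ max(μ, √y)) and the remark after it (Rychlewski–Whittington [RW11]: μ(y) ∼ √y)] -/
theorem stripMuY₀_sq_le_sharp (T : ℕ) (hy : 1 ≤ y) : stripMuY₀ T y ^ 2 ≤ y + 1 / y + 8748 / y ^ 2 := by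
  have hy0 : 0 < y := by linarith
  have h1 : stripMuY₀ T y ≤ HV.surfaceMu y := stripMuY₀_le_surfaceMu T hy0
  have h2 : HV.surfaceMu y = Wall.wallRate y := (HV.wallRate_eq_surfaceMu hy0).symm
  have h3 := (Wall.wallRate_sq_sub_sub_mem_Icc hy).2
  have h4 : stripMuY₀ T y ^ 2 ≤ Wall.wallRate y ^ 2 :=
    pow_le_pow_left₀ (stripMuY₀_pos T hy0).le (h1.trans_eq h2) 2
  linarith

/-- **`y + y/(U(U−1)) ≤ μ_T(y,1)²`**, `U = y + 1/y + 8748/y²`, for every `T ≥ 1` and `y ≥ 1`: at width one `s − y = y·…/(s(s−1)) ≥ y/(U(U−1))`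
by the lower sextic law, and `μ_T(y,1)` is non-decreasing in `T`. [cite: BeatonBousquetMelouDeGierDuminilCopinGuttmann2014, §3.2 Propositions 6–7 (arXiv v5 pp. 10–11)] -/
theorem sharp_le_stripMuY₀_sq (hT : 1 ≤ T) (hy : 1 ≤ y) :
    y + y / ((y + 1 / y + 8748 / y ^ 2) * (y + 1 / y + 8748 / y ^ 2 - 1)) ≤ stripMuY₀ T y ^ 2 := by
  have hy0 : 0 < y := by linarith
  set U : ℝ := y + 1 / y + 8748 / y ^ 2 with hU
  set s : ℝ := stripMuY₀ 1 y ^ 2 with hs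
  -- width one: `y < s`, `1 < s`, `y ≤ s(s−y)(s−1)`
  have hm := max_lt_stripMuY₀_one_sq hy0
  have hlaw := le_stripMuY₀_one_sq_poly hy0
  rw [← hs] at hm hlaw
  have hys : y < s := lt_of_le_of_lt (le_max_left y 1) hm
  have h1s : 1 < s := lt_of_le_of_lt (le_max_right y 1) hm
  -- monotone in `T`, and the upper window
  have hsT : s ≤ stripMuY₀ T y ^ 2 := by
    rw [hs]; exact pow_le_pow_left₀ (stripMuY₀_pos 1 hy0).le (stripMuY₀_mono hT hy0) 2
  have hsU : s ≤ U := (hsT.trans (stripMuY₀_sq_le_sharp T hy)).trans_eq hU.symm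
  have hU1 : 1 < U := h1s.trans_le hsU
  have hss : 0 < s * (s - 1) := mul_pos (by linarith) (by linarith)
  have hUU : s * (s - 1) ≤ U * (U - 1) := mul_le_mul hsU (by linarith) (by linarith) (by linarith)
  -- `s − y ≥ y/(s(s−1)) ≥ y/(U(U−1))`
  have h1 : y / (U * (U - 1)) ≤ y / (s * (s - 1)) := div_le_div_of_nonneg_left hy0.le hss hUU
  have h2 : y / (s * (s - 1)) ≤ s - y := by
    rw [div_le_iff₀ hss]; linarith [hlaw]
  linarith

/-- ★★ **THE ONE-WALL SECOND-ORDER LAW FOR EVERY STRIP WIDTH: `μ_T(y,1)² ∈ [y + 1/y, y + 1/y + 8748/y²]` for all `T ≥ 1`, `y ≥ 200`**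
— the same second-order coefficient `1` as the half plane, uniformly in the width. [cite: BeatonBousquetMelouDeGierDuminilCopinGuttmann2014, §3.2 Proposition 7 (arXiv v5 p. 11) and §3.1 Proposition 5 (μ(y) ≥ max(μ, √y)) and the remark after it (Rychlewski–Whittington [RW11]: μ(y) ∼ √y)] -/
theorem stripMuY₀_sq_mem_Icc (hT : 1 ≤ T) (hy : 200 ≤ y) :
    stripMuY₀ T y ^ 2 ∈ Set.Icc (y + 1 / y) (y + 1 / y + 8748 / y ^ 2) := by
  have hy1 : 1 ≤ y := by linarith
  have hy0 : 0 < y := by linarith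
  refine ⟨?_, stripMuY₀_sq_le_sharp T hy1⟩
  have h := sharp_le_stripMuY₀_sq hT hy1
  -- `y/(U(U−1)) ≥ 1/y` because `U(U−1) ≤ y²` for `y ≥ 200`
  set e : ℝ := 1 / y + 8748 / y ^ 2 with he
  have he0 : 0 < e := by positivity
  have he1 : e ≤ 1 / 4 := by
    rw [he]
    have a : 1 / y ≤ 1 / 200 := one_div_le_one_div_of_le (by norm_num) hy
    have b : 8748 / y ^ 2 ≤ 8748 / 200 ^ 2 := div_le_div_of_nonneg_left (by norm_num) (by positivity) (by nlinarith)
    norm_num at a b ⊢; linarith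
  have hUe : y + 1 / y + 8748 / y ^ 2 = y + e := by rw [he]; ring
  rw [hUe] at h
  have hprod : (y + e) * (y + e - 1) ≤ y ^ 2 := by nlinarith
  have hpos : 0 < (y + e) * (y + e - 1) := mul_pos (by linarith) (by linarith)
  have h3 : 1 / y ≤ y / ((y + e) * (y + e - 1)) := by
    rw [div_le_div_iff₀ hy0 hpos]; nlinarith
  linarith

/-- ★★ **`|y·(μ_T(y,1)² − y) − 1| ≤ 8748/y`** for every `T ≥ 1`, `y ≥ 200` (and the deviation is non-negative).
[cite: BeatonBousquetMelouDeGierDuminilCopinGuttmann2014, §3.2 Proposition 7 (arXiv v5 p. 11) and §3.1 Proposition 5 and the remark after it (μ(y) ∼ √y)] -/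
theorem abs_mul_stripMuY₀_sq_sub_sub_one_le (hT : 1 ≤ T) (hy : 200 ≤ y) :
    |y * (stripMuY₀ T y ^ 2 - y) - 1| ≤ 8748 / y := by
  have hy0 : 0 < y := by linarith
  obtain ⟨h1, h2⟩ := stripMuY₀_sq_mem_Icc hT hy
  have e1 : y * (y + 1 / y - y) - 1 = 0 := by field_simp; ring
  have e2 : y * (y + 1 / y + 8748 / y ^ 2 - y) - 1 = 8748 / y := by field_simp; ring
  rw [abs_le]
  constructor
  · have : y * (y + 1 / y - y) ≤ y * (stripMuY₀ T y ^ 2 - y) := mul_le_mul_of_nonneg_left (by linarith) hy0.le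
    have : 0 ≤ 8748 / y := by positivity
    linarith
  · have : y * (stripMuY₀ T y ^ 2 - y) ≤ y * (y + 1 / y + 8748 / y ^ 2 - y) := mul_le_mul_of_nonneg_left (by linarith) hy0.le
    linarith

/-- ★★ **`y·(μ_T(y,1)² − y) → 1` as `y → ∞`, for every fixed width `T ≥ 1`** — the strip twin of the half-plane law of
`HexSAWSurfaceSecondOrderSharp`. [cite: BeatonBousquetMelouDeGierDuminilCopinGuttmann2014, §3.2 Proposition 7 (arXiv v5 p. 11) and §3.1 Proposition 5 (μ(y) ≥ max(μ, √y)) and the remark after it (Rychlewski–Whittington [RW11]: μ(y) ∼ √y)] -/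
theorem tendsto_mul_stripMuY₀_sq_sub (hT : 1 ≤ T) :
    Tendsto (fun y : ℝ => y * (stripMuY₀ T y ^ 2 - y)) atTop (𝓝 1) := by
  have hlim : Tendsto (fun y : ℝ => (8748 : ℝ) / y) atTop (𝓝 0) := tendsto_const_nhds.div_atTop tendsto_id
  have hlim' : Tendsto (fun y : ℝ => 1 + (8748 : ℝ) / y) atTop (𝓝 1) := by simpa using tendsto_const_nhds.add hlim
  refine tendsto_of_tendsto_of_tendsto_of_le_of_le' tendsto_const_nhds hlim' ?_ ?_
  · filter_upwards [Filter.eventually_ge_atTop (200 : ℝ)] with y hy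
    have := (abs_le.1 (abs_mul_stripMuY₀_sq_sub_sub_one_le hT hy)).1
    have h0 : 0 ≤ y * (stripMuY₀ T y ^ 2 - y) - 1 := by
      obtain ⟨h1, -⟩ := stripMuY₀_sq_mem_Icc hT hy
      have hy0 : 0 < y := by linarith
      have : y * (y + 1 / y - y) ≤ y * (stripMuY₀ T y ^ 2 - y) := mul_le_mul_of_nonneg_left (by linarith) hy0.le
      have e1 : y * (y + 1 / y - y) = 1 := by field_simp; ring
      linarith
    linarith
  · filter_upwards [Filter.eventually_ge_atTop (200 : ℝ)] with y hy
    have := (abs_le.1 (abs_mul_stripMuY₀_sq_sub_sub_one_le hT hy)).2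
    linarith

/-- ★★ **Adsorbed-phase locality, uniform in the width: `0 ≤ μ(y)² − μ_T(y,1)² ≤ 8748/y²` for every `T ≥ 1`, `y ≥ 200`** — with one
strongly attractive wall the one-cell slit already carries the half-plane free energy up to `O(y⁻²)` (the printed Proposition 7 has
`μ_T(y) ↑ μ(y)`; the lane's desorbed-side rate is `30/√T`, `HexSAWBrickWallStripFugacityLevel0Locality`).
[cite: BeatonBousquetMelouDeGierDuminilCopinGuttmann2014, §3.2 Proposition 7 (arXiv v5 p. 11: μ_T(y) increasing to μ(y))] -/
theorem surfaceMu_sq_sub_stripMuY₀_sq_mem_Icc (hT : 1 ≤ T) (hy : 200 ≤ y) :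
    HV.surfaceMu y ^ 2 - stripMuY₀ T y ^ 2 ∈ Set.Icc 0 (8748 / y ^ 2) := by
  have hy0 : 0 < y := by linarith
  have hy1 : 1 ≤ y := by linarith
  have h1 : stripMuY₀ T y ≤ HV.surfaceMu y := stripMuY₀_le_surfaceMu T hy0
  have h2 : HV.surfaceMu y = Wall.wallRate y := (HV.wallRate_eq_surfaceMu hy0).symm
  have h3 := (Wall.wallRate_sq_sub_sub_mem_Icc hy1).2
  have h4 : stripMuY₀ T y ^ 2 ≤ HV.surfaceMu y ^ 2 := pow_le_pow_left₀ (stripMuY₀_pos T hy0).le h1 2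
  obtain ⟨h5, -⟩ := stripMuY₀_sq_mem_Icc hT hy
  rw [h2] at h4 ⊢
  exact ⟨by linarith, by linarith⟩

end Literature.Probability.RandomPlanarGeometry.SAW.HexBW
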